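import Summits.QuantumFields.YangMills.Theorems.UnitScaleTiltProp8ChartHInvGradLetter
import Summits.QuantumFields.YangMills.Theorems.UnitScaleTiltProp8ChartHInvSmoothTent64
import HarnessLib

/-!
# Route `UnitScaleTilt`, crux K1 «MinimiserStabilityRegPr» (stmt-QuantumFields-19200), leaf V2′ — the P2→P3 BRIDGE (hH of `ChartRemainderAt`),
# part C3′: **THE PACKAGED BRIDGE WITH BOTH (46) ROWS — `exists_rightInverse₂`** (WANTED №g26-1 (X3′), OWNER RULING g26 04:53:50Z, condition (1): the identity
# clause and the sup-row shape of `ChartHInv.exists_rightInverse` LITERALLY, slope constant `2 → 8`, plus the gradient row)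

Cell `ym3-torus`, width seat `ym-ust-19200-w5` gen 3 (count-neutral helper; `--supports stmt-QuantumFields-19200 --as helper`; def-free, 0 sorry).

WHAT THIS FILE PROVES.  ★★ **`exists_rightInverse₂`** — for a (2.2)-admissible nested family (`Adm22 D R M`, `2L ≤ R·M + 1`), `η > 0`, the territory weights
`w₁ b = L^{lev(b₋)}η`, `w₂ b = (L^{lev(b₋)}η)²`, and a real right inverse `H₀` of the straight averages with BOTH (46) rows (P2's ✓ `HSupLetterG` for `flatH`:
`w₁ b|H₀X(b)| ≤ B₀·t` and `w₂ b·η⁻¹·|H₀X(b+e_ν) − H₀X(b)| ≤ B₀·t` for data `(L^{j(c)}η)|X(c)| ≤ t`): a ℂ-linear `H` on matrix data with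
(i) `η·Q^{(j)}(HX) = X` on the index bonds (the identity clause of `exists_rightInverse`, verbatim), (ii) the sup row `w₁ b·‖HX b‖ ≤ B₀(1+2C)(1+8C+8C·L)·t`
(`C = (d+2)L`; the shape of record with the tents' slope constant `2 → 8`), (iii) the GRADIENT row `w₂ b·η⁻¹·‖HX⟨b₋+e_ν, dir b⟩ − HX b‖ ≤ B₀(1+2C)(1+256C·L⁴)·t` —
the construction of parts A∕C1 on the C^{1,1} tents of part B2′ (`exists_smoothTent64`), rows by part C2′ (`letter_of_slope`, `letter_grad`).
So the two-letter consumers of the chart-`H` (`FlatProp4Dressing.hWq_of_dressing`'s `hH`, `HalvingSize152OfChart.size152_bond`'s `hH'`) have a supplier k-uniformly;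
the carrier reading (`η = L^{−(K−n)}`, `IsLevWeight`, P2's `flatH`, pattern of `ChartHInvFromFlatOps.hH_of_flatH`) is one screen and is left to the consumer∕next file.
HONEST SCOPE: packaging; nothing of Bałaban's asserted.  NOT a claim about the mass gap.

References: T. Bałaban, CMP **102** (1985) 277–309 [Balaban1985Variational] ((45)–(46) p.285, (152) p.301, (156)–(157) p.302); CMP **96** (1984) 223–250
[Balaban1984PropagatorsII] ((2.1)–(2.4) p.224, (2.20) p.226).
-/

set_option autoImplicit false

noncomputable section

open scoped BigOperators Matrix.Norms.L2Operator

namespace Summit.QuantumFields.YangMills.Theorems.ChartHInv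

open Literature.MathematicalPhysics.QuantumFieldTheory.Balaban1983to89
open T4Continuum BlockAveraging BlockAveragingEMLLinearised LatticeFieldCalculus
open B5Eq118OneStroke (iterBlockOf)
open B15DeterminingSets (embIter)
open B6SectADomainsV1 (Domains)
open B6SectAOperatorsV1 (BondIdx SiteIdx)
open B11Eq115Space (levOf)
open Summit.QuantumFields.YangMills.Theorems.FlatCubeOpsText (Adm22)

variable {P : Params} {n : Type*} [Fintype n] [DecidableEq n]

/-- **THE P2→P3 BRIDGE WITH BOTH (46) ROWS, k-UNIFORMLY** (see the module docstring). [cite: Balaban1985Variational, (45)-(46) p.285, (152) p.301, (156)-(157) p.302] -/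
theorem exists_rightInverse₂ (D : Domains P) {R M : ℕ} (hAdm : Adm22 D R M) (hRM : 2 * P.L ≤ R * M + 1) {η : ℝ} (hη : 0 < η)
    (w₁ : PBond P 0 → ℝ) (hw₁ : ∀ b, w₁ b = (P.L : ℝ) ^ levOf (fun i => {z : Site P 0 | D.InOm i z}) D.k b.src * η)
    (w₂ : PBond P 0 → ℝ) (hw₂ : ∀ b, w₂ b = ((P.L : ℝ) ^ levOf (fun i => {z : Site P 0 | D.InOm i z}) D.k b.src * η) ^ 2)
    (H₀ : (BondIdx D → ℝ) →ₗ[ℝ] (PBond P 0 → ℝ)) (hinv : ∀ (X : BondIdx D → ℝ) (i : BondIdx D), bondAvgIter (i.1.1 : ℕ) (H₀ X) i.1.2 = X i)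
    {B₀ : ℝ} (hB₀ : 0 ≤ B₀)
    (hsup : ∀ (Xr : BondIdx D → ℝ) (t : ℝ), 0 ≤ t → (∀ i, ((P.L : ℝ) ^ (i.1.1 : ℕ) * η) * |Xr i| ≤ t) → ∀ b, w₁ b * |H₀ Xr b| ≤ B₀ * t)
    (hgrad : ∀ (Xr : BondIdx D → ℝ) (t : ℝ), 0 ≤ t → (∀ i, ((P.L : ℝ) ^ (i.1.1 : ℕ) * η) * |Xr i| ≤ t) →
      ∀ (b : PBond P 0) (ν : Fin P.d), w₂ b * η⁻¹ * |H₀ Xr ⟨b.src.shift ν, b.dir⟩ - H₀ Xr b| ≤ B₀ * t)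
    (Q : (i : ℕ) → (PBond P 0 → Matrix n n ℂ) → PBond P i → Matrix n n ℂ)
    (hQ0 : ∀ Y, Q 0 Y = Y) (hQs : ∀ (i : ℕ) (Y : PBond P 0 → Matrix n n ℂ) (c : PBond P (i + 1)), Q (i + 1) Y c = linAvg (Q i Y) c) :
    ∃ H : (BondIdx D → Matrix n n ℂ) →ₗ[ℂ] (PBond P 0 → Matrix n n ℂ),
      (∀ (X : BondIdx D → Matrix n n ℂ) (idx : BondIdx D), (η : ℂ) • Q (idx.1.1 : ℕ) (H X) idx.1.2 = X idx) ∧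
      (∀ (X : BondIdx D → Matrix n n ℂ) (t : ℝ), 0 ≤ t → (∀ i, ‖X i‖ ≤ t) → ∀ b : PBond P 0,
        w₁ b * ‖H X b‖ ≤ B₀ * ((1 + 2 * ((P.d + 2) * P.L : ℕ)) * (1 + 8 * ((P.d + 2) * P.L : ℕ) + 8 * ((P.d + 2) * P.L : ℕ) * P.L)) * t) ∧
      ∀ (X : BondIdx D → Matrix n n ℂ) (t : ℝ), 0 ≤ t → (∀ i, ‖X i‖ ≤ t) → ∀ (b : PBond P 0) (ν : Fin P.d),
        w₂ b * η⁻¹ * ‖H X ⟨b.src.shift ν, b.dir⟩ - H X b‖ ≤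
          B₀ * ((1 + 2 * ((P.d + 2) * P.L : ℕ)) * (1 + 256 * ((P.d + 2) * P.L : ℕ) * (P.L : ℝ) ^ 4)) * t := by
  classical
  obtain ⟨Λ, hΛ0, hΛs⟩ := exists_combFamily (P := P) (n := n)
  have htent := fun s : SiteIdx D => exists_smoothTent64 (P := P) (j := (s.1.1 : ℕ)) ((D.le_of_lamSite s.2).trans D.hk) s.1.2
  choose τ hτ1 hτ0 _hτ01 hτlip hτd2 using htent
  obtain ⟨Xf, hXf⟩ : ∃ Xf : (BondIdx D → Matrix n n ℂ) → (i : ℕ) → PBond P i → Matrix n n ℂ,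
      ∀ X i b, Xf X i b = if h : D.LamBond i b then X ⟨⟨⟨i, Nat.lt_succ_of_le (D.le_of_lamBond h)⟩, b⟩, h⟩ else 0 := ⟨_, fun _ _ _ => rfl⟩
  obtain ⟨κ, hκ0, hκs⟩ : ∃ κ : (BondIdx D → Matrix n n ℂ) → (j : ℕ) → Site P j → Matrix n n ℂ,
      (∀ X y, κ X 0 y = 0) ∧ ∀ X (i : ℕ) (y : Site P (i + 1)), κ X (i + 1) y = if y ∈ D.Om (i + 1) then 0 else combMean (Xf X i) y :=
    ⟨fun X j => Nat.rec (motive := fun j => Site P j → Matrix n n ℂ) (fun _ => 0)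
      (fun i _ y => if y ∈ D.Om (i + 1) then 0 else combMean (Xf X i) y) j, fun _ _ => rfl, fun _ _ _ => rfl⟩
  obtain ⟨Xt, hXt⟩ : ∃ Xt : (BondIdx D → Matrix n n ℂ) → BondIdx D → Matrix n n ℂ,
      ∀ X idx, Xt X idx = (((P.L : ℝ) ^ (idx.1.1 : ℕ) * η)⁻¹) • (X idx + (κ X idx.1.1 idx.1.2.tgt - κ X idx.1.1 idx.1.2.src)) :=
    ⟨_, fun _ _ => rfl⟩
  obtain ⟨Y, hY⟩ : ∃ Y : (BondIdx D → Matrix n n ℂ) → PBond P 0 → Matrix n n ℂ, ∀ X b, Y X b = ∑ i : BondIdx D, H₀ (Pi.single i 1) b • Xt X i :=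
    ⟨_, fun _ _ => rfl⟩
  obtain ⟨φ, hφ⟩ : ∃ φ : (BondIdx D → Matrix n n ℂ) → Site P 0 → Matrix n n ℂ, ∀ X x, φ X x = ∑ s : SiteIdx D, τ s x • Λ (s.1.1 : ℕ) (Y X) s.1.2 :=
    ⟨_, fun _ _ => rfl⟩
  obtain ⟨Hf, hHf⟩ : ∃ Hf : (BondIdx D → Matrix n n ℂ) → PBond P 0 → Matrix n n ℂ, ∀ X b, Hf X b = Y X b + (φ X b.tgt - φ X b.src) :=
    ⟨_, fun _ _ => rfl⟩
  -- linearity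
  have hadd : ∀ X X', Hf (X + X') = Hf X + Hf X' := fun X X' => funext fun b => by
    rw [Pi.add_apply, hHf, hHf, hHf, Y_add D η Xf hXf κ hκ0 hκs Xt hXt H₀ Y hY,
      phi_add D η Λ hΛ0 hΛs Xf hXf κ hκ0 hκs Xt hXt H₀ Y hY τ φ hφ, phi_add D η Λ hΛ0 hΛs Xf hXf κ hκ0 hκs Xt hXt H₀ Y hY τ φ hφ]
    abel
  have hsmul : ∀ (a : ℂ) X, Hf (a • X) = a • Hf X := fun a X => funext fun b => by
    rw [Pi.smul_apply, hHf, hHf, Y_smul D η Xf hXf κ hκ0 hκs Xt hXt H₀ Y hY,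
      phi_smul D η Λ hΛ0 hΛs Xf hXf κ hκ0 hκs Xt hXt H₀ Y hY τ φ hφ, phi_smul D η Λ hΛ0 hΛs Xf hXf κ hκ0 hκs Xt hXt H₀ Y hY τ φ hφ,
      smul_add, smul_sub]
  let H : (BondIdx D → Matrix n n ℂ) →ₗ[ℂ] (PBond P 0 → Matrix n n ℂ) :=
    { toFun := Hf, map_add' := hadd, map_smul' := hsmul }
  have hRM1 : 1 ≤ R * M := by have := P.hL.2; omega
  have h8 : (0 : ℝ) ≤ 8 := by norm_num
  have hτlip8 : ∀ (s : SiteIdx D) (b : PBond P 0), |τ s b.tgt - τ s b.src| ≤ 8 / (P.L : ℝ) ^ (s.1.1 : ℕ) := fun s b => hτlip s b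
  refine ⟨H, fun X idx => ?_, fun X t ht hX b => ?_, fun X t ht hX b ν => ?_⟩
  · show (η : ℂ) • Q (idx.1.1 : ℕ) (Hf X) idx.1.2 = X idx
    rw [show Hf X = fun b => Y X b + (φ X b.tgt - φ X b.src) from funext (hHf X)]
    exact main_identity D η Q hQ0 hQs Λ hΛ0 hΛs Xf hXf κ hκ0 hκs Xt hXt H₀ hinv Y hY τ hτ1 hτ0 φ hφ hAdm hRM hη.ne' X idx
  · show w₁ b * ‖Hf X b‖ ≤ _
    have h := letter_of_slope D η Λ hΛ0 hΛs Xf hXf κ hκ0 hκs Xt hXt H₀ Y hY τ hτ0 φ hφ w₁ hw₁ hsup h8 hτlip8 hAdm hRM1 hη hB₀ Hf hHf X ht hX b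
    calc w₁ b * ‖Hf X b‖ ≤ B₀ * ((1 + 2 * ((P.d + 2) * P.L : ℕ)) * (1 + 8 * ((P.d + 2) * P.L : ℕ) * (1 + P.L))) * t := h
      _ = _ := by ring
  · show w₂ b * η⁻¹ * ‖Hf X ⟨b.src.shift ν, b.dir⟩ - Hf X b‖ ≤ _
    exact letter_grad D η Λ hΛ0 hΛs Xf hXf κ hκ0 hκs Xt hXt H₀ Y hY τ hτ0 φ hφ w₁ hw₁ w₂ hw₂ hsup hgrad hτd2 hAdm hRM1 hη hB₀ Hf hHf X ht hX b ν

end Summit.QuantumFields.YangMills.Theorems.ChartHInv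

end
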